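import Mathlib
import Summits.NavierStokesRegularity.NavierStokesRegularity.Theses.ClockStretchingLaw
import Summits.NavierStokesRegularity.NavierStokesRegularity.Theorems.ClockStretchingLawClockCeilingIffTarget
import Summits.NavierStokesRegularity.NavierStokesRegularity.Theorems.ClockStretchingLawClockCeilingUniformClockLaw
import Summits.NavierStokesRegularity.NavierStokesRegularity.Theorems.ClockStretchingLawClockCeilingUniformFrameLaw
import Summits.NavierStokesRegularity.NavierStokesRegularity.Theorems.ClockStretchingLawClockCeilingFarPastStretchingRung
import Summits.NavierStokesRegularity.NavierStokesRegularity.Theorems.ClockStretchingLawClockCeilingFarPastIntegrableExcess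
import Summits.NavierStokesRegularity.NavierStokesRegularity.Theorems.ClockStretchingLawClockCeilingSingularStretchingNearZero
import Summits.NavierStokesRegularity.NavierStokesRegularity.Theorems.ClockStretchingLawClockCeilingLocalisedVorticityFloor
import Literature.Analysis.FluidPDE.TypeIAncientMild
import HarnessLib

/-!
# Route ClockStretchingLaw, crux `ClockCeiling` (stmt-NavierStokesRegularity-10570) — PORTRAIT OF
# A COUNTEREXAMPLE (one-stop kill list)

The crux `ClockCeiling` is kernel-checked equivalent to the Type-I ancient Liouville statement
(item stmt-NavierStokesRegularity-4050, `clockCeiling_iff_typeIAncientLiouville`) and is decided on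
the SINGULAR elements of the class `𝒦_C` alone (`clockCeiling_iff_singular`). This file assembles,
in ONE declaration, everything the tree knows a counterexample must look like:

**`not_clockCeiling_portrait`.** If `ClockCeiling` fails, there are `C` and `u ∈ 𝒦_C`
(`IsTypeIAncientMild C u` with the scale-invariant energy ledger `A, E ≤ C`) such that
1. `u` is singular at the space–time origin (unbounded on every `Q(0, r)`);
2. CLOCK FLOOR at all times: `∃ δ > 0 ∀ t < 0, a_u(t) = (−t)^{3/2}∫‖∂ₜu‖²e^{−|x|²/(4(−t))} ≥ δ`
   (`stub_uniformClockLaw`, p153352);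
3. FRAME FLOOR at all times and all unit directions `c₀² + ‖b‖² = 1`:
   `√(−t)∫‖c₀√(−t)∂ₜu + ∂_b u‖² e^{−|x|²/(4(−t))} ≥ η` (`stub_uniformFrameLaw`, p154492);
4. LOCALISED VORTICITY FLOOR at all times: `∃ η > 0 ∃ R > 0 ∀ t < 0 ∃ ‖x‖ < R√(−t)`,
   `(−t)‖ω(t,x)‖ ≥ η` (`localisedVorticityFloor`, p160189);
5. FAR-PAST STRETCHING: `∀ T ≤ 0 ∀ θ < 1 ∃ t < T ∃ x`, `ω(t,x) ≠ 0 ∧ (−t)⟪∇u ξ, ξ⟫ > θ`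
   (`farPastStretchingRung`, p159076);
6. NEAR-ZERO STRETCHING: `∀ T < 0 ∀ θ < 1 ∃ t ∈ (T, 0) ∃ x`, `ω(t,x) ≠ 0 ∧ (−t)⟪∇u ξ, ξ⟫ > θ`
   (`singularStretchingNearZero`, p159489);
7. NON-INTEGRABLE EXCESS: for all `T ≤ 0`, `θ < 1` and every smooth `H` bounded below,
   `∃ t < T ∃ x`, `ω(t,x) ≠ 0 ∧ (−t)⟪∇u ξ, ξ⟫ > θ + (−t)H'(t)`
   (`farPastIntegrableExcessRung`, p160073).

Pure glue over the landed clauses; no new analysis.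
-/

noncomputable section

-- the summit and its single sub-problem share the name (CONVENTIONS §1), as in every Theorems file
set_option linter.dupNamespace false

open MeasureTheory Filter Topology Set Metric Function
open scoped RealInnerProductSpace ContDiff

namespace Summit.NavierStokesRegularity.NavierStokesRegularity.Theorems

open Literature.Analysis Literature.Analysis.FluidPDE
open Summit.NavierStokesRegularity.NavierStokesRegularity.Theses.ClockStretchingLaw

/-- **Portrait of a counterexample to `ClockCeiling` (kill list).** If the crux fails, some
singular element `u ∈ 𝒦_C` carries, simultaneously: the all-time clock floor, the all-time
frame floor, the localised all-time vorticity floor, gauge vortex stretching `≥ 1⁻` both as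
`t → −∞` and as `t → 0⁻`, and a stretching excess over every `θ < 1` that no bounded-below smooth
Lyapunov function absorbs in the far past. (Assembly of `clockCeiling_iff_singular`,
`stub_uniformClockLaw`, `stub_uniformFrameLaw`, `localisedVorticityFloor`, `farPastStretchingRung`,
`singularStretchingNearZero`, `farPastIntegrableExcessRung`.) [folklore] -/
theorem not_clockCeiling_portrait (hneg : ¬ ClockCeiling) :
    ∃ (C : ℝ) (u : ℝ → EuclideanSpace ℝ (Fin 3) → EuclideanSpace ℝ (Fin 3)),
      IsTypeIAncientMild C u ∧
      (∀ (x₀ : EuclideanSpace ℝ (Fin 3)) (t₀ r : ℝ), t₀ ≤ 0 → 0 < r →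
        (∀ t, t₀ - r ^ 2 < t → t < t₀ → r⁻¹ * ∫ x in Metric.ball x₀ r, ‖u t x‖ ^ 2 ≤ C) ∧
          r⁻¹ * ∫ t in Set.Ioo (t₀ - r ^ 2) t₀, ∫ x in Metric.ball x₀ r, ‖fderiv ℝ (u t) x‖ ^ 2 ≤ C) ∧
      -- (1) singular at the space–time origin
      (∀ r > 0, ∀ M : ℝ, ∃ t ∈ Set.Ioo (-(r ^ 2)) (0 : ℝ),
        ∃ x ∈ Metric.ball (0 : EuclideanSpace ℝ (Fin 3)) r, M < ‖u t x‖) ∧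
      -- (2) clock floor at all times
      (∃ δ > 0, ∀ t < 0, δ ≤ (-t) ^ ((3 : ℝ) / 2) *
        ∫ x, ‖timeDeriv u t x‖ ^ 2 * Real.exp (-(‖x‖ ^ 2) / (4 * (-t)))) ∧
      -- (3) frame floor at all times
      (∃ η > 0, ∀ t < 0, ∀ (c₀ : ℝ) (b : EuclideanSpace ℝ (Fin 3)), c₀ ^ 2 + ‖b‖ ^ 2 = 1 →
        η ≤ Real.sqrt (-t) * ∫ x, ‖(c₀ * Real.sqrt (-t)) • timeDeriv u t x + fderiv ℝ (u t) x b‖ ^ 2 *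
          Real.exp (-(‖x‖ ^ 2) / (4 * (-t)))) ∧
      -- (4) localised vorticity floor at all times
      (∃ η > 0, ∃ R > 0, ∀ t < 0, ∃ x ∈ Metric.ball (0 : EuclideanSpace ℝ (Fin 3)) (R * Real.sqrt (-t)),
        η ≤ (-t) * ‖curl (u t) x‖) ∧
      -- (5) far-past stretching at gauge rate `> θ` for every `θ < 1`
      (∀ T ≤ 0, ∀ θ < 1, ∃ t < T, ∃ x, curl (u t) x ≠ 0 ∧
        θ < (-t) * ⟪fderiv ℝ (u t) x (vorticityDirection (curl (u t)) x),
          vorticityDirection (curl (u t)) x⟫) ∧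
      -- (6) near-zero stretching at gauge rate `> θ` for every `θ < 1`
      (∀ T < 0, ∀ θ < 1, ∃ t ∈ Set.Ioo T 0, ∃ x, curl (u t) x ≠ 0 ∧
        θ < (-t) * ⟪fderiv ℝ (u t) x (vorticityDirection (curl (u t)) x),
          vorticityDirection (curl (u t)) x⟫) ∧
      -- (7) the stretching excess is absorbed by no bounded-below smooth Lyapunov function
      (∀ T ≤ 0, ∀ θ < 1, ∀ (H : ℝ → ℝ) (B : ℝ), ContDiff ℝ ∞ H → (∀ t, B ≤ H t) →
        ∃ t < T, ∃ x, curl (u t) x ≠ 0 ∧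
          θ + (-t) * deriv H t < (-t) * ⟪fderiv ℝ (u t) x (vorticityDirection (curl (u t)) x),
            vorticityDirection (curl (u t)) x⟫) := by
  -- a singular element violating the ceiling
  rw [clockCeiling_iff_singular] at hneg
  push Not at hneg
  obtain ⟨C, u, hu, hE, hsing, -⟩ := hneg
  have hne : ¬ ∀ t < 0, ∀ x, u t x = 0 := by
    intro h0
    obtain ⟨t, ht, x, -, hM⟩ := hsing 1 one_pos 0
    rw [h0 t ht.2 x, norm_zero] at hM
    exact lt_irrefl _ hM
  -- the inline (route-vocabulary) form of the class hypothesis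
  obtain ⟨h1, h2, h3, h4⟩ := (isTypeIAncientMild_iff (C := C) (u := u)).1 hu
  refine ⟨C, u, hu, hE, hsing, ?_, ?_, ?_, ?_, ?_, ?_⟩
  · -- (2) clock floor
    obtain ⟨δ, hδ, hlaw⟩ := stub_uniformClockLaw C
    exact ⟨δ, hδ, fun t ht => hlaw u ⟨h1, h2, fun s t hst ht x => by rw [h3 s t hst ht x]; rfl, h4, hE⟩
      hsing t ht⟩
  · -- (3) frame floor
    obtain ⟨η, hη, hlaw⟩ := stub_uniformFrameLaw C
    exact ⟨η, hη, fun t ht c₀ b hcb =>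
      hlaw u ⟨h1, h2, fun s t hst ht x => by rw [h3 s t hst ht x]; rfl, h4, hE⟩ hsing t ht c₀ b hcb⟩
  · -- (4) localised vorticity floor
    obtain ⟨η, hη, R, hR, hfloor⟩ := localisedVorticityFloor C
    exact ⟨η, hη, R, hR, fun t ht => hfloor u hu hE hsing t ht⟩
  · -- (5) far-past stretching
    intro T hT θ hθ
    by_contra h
    push Not at h
    exact hne (farPastStretchingRung hu hT hθ fun t ht x hω => h t ht x hω)
  · -- (6) near-zero stretching
    intro T hT θ hθ
    exact singularStretchingNearZero hu hE hsing hT hθ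
  · -- (7) non-integrable excess
    intro T hT θ hθ H B hH hHB
    by_contra h
    push Not at h
    exact hne (farPastIntegrableExcessRung hu hT hθ hH hHB fun t ht x hω => h t ht x hω)

/-- **Stub `stub_counterexamplePortrait` (crux stmt-NavierStokesRegularity-10570, line `registered`):
the kill list of `not_clockCeiling_portrait` with fully qualified names** — if `ClockCeiling`
fails, some singular `u ∈ 𝒦_C` carries the clock floor, the frame floor, the localised vorticity
floor, gauge vortex stretching `> θ` for every `θ < 1` as `t → −∞` and as `t → 0⁻`, and a
stretching excess absorbed by no bounded-below smooth Lyapunov function. [folklore] -/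
theorem stub_counterexamplePortrait :
    ¬ Summit.NavierStokesRegularity.NavierStokesRegularity.Theses.ClockStretchingLaw.ClockCeiling →
    ∃ (C : ℝ) (u : ℝ → EuclideanSpace ℝ (Fin 3) → EuclideanSpace ℝ (Fin 3)),
      Literature.Analysis.FluidPDE.IsTypeIAncientMild C u ∧
      (∀ (x₀ : EuclideanSpace ℝ (Fin 3)) (t₀ r : ℝ), t₀ ≤ 0 → 0 < r →
        (∀ t, t₀ - r ^ 2 < t → t < t₀ → r⁻¹ * ∫ x in Metric.ball x₀ r, ‖u t x‖ ^ 2 ≤ C) ∧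
          r⁻¹ * ∫ t in Set.Ioo (t₀ - r ^ 2) t₀, ∫ x in Metric.ball x₀ r, ‖fderiv ℝ (u t) x‖ ^ 2 ≤ C) ∧
      (∀ r > 0, ∀ M : ℝ, ∃ t ∈ Set.Ioo (-(r ^ 2)) (0 : ℝ),
        ∃ x ∈ Metric.ball (0 : EuclideanSpace ℝ (Fin 3)) r, M < ‖u t x‖) ∧
      (∃ δ > 0, ∀ t < 0, δ ≤ (-t) ^ ((3 : ℝ) / 2) *
        ∫ x, ‖Literature.Analysis.FluidPDE.timeDeriv u t x‖ ^ 2 * Real.exp (-(‖x‖ ^ 2) / (4 * (-t)))) ∧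
      (∃ η > 0, ∀ t < 0, ∀ (c₀ : ℝ) (b : EuclideanSpace ℝ (Fin 3)), c₀ ^ 2 + ‖b‖ ^ 2 = 1 →
        η ≤ Real.sqrt (-t) * ∫ x, ‖(c₀ * Real.sqrt (-t)) • Literature.Analysis.FluidPDE.timeDeriv u t x +
          fderiv ℝ (u t) x b‖ ^ 2 * Real.exp (-(‖x‖ ^ 2) / (4 * (-t)))) ∧
      (∃ η > 0, ∃ R > 0, ∀ t < 0, ∃ x ∈ Metric.ball (0 : EuclideanSpace ℝ (Fin 3)) (R * Real.sqrt (-t)),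
        η ≤ (-t) * ‖Literature.Analysis.FluidPDE.curl (u t) x‖) ∧
      (∀ T ≤ 0, ∀ θ < 1, ∃ t < T, ∃ x : EuclideanSpace ℝ (Fin 3), Literature.Analysis.FluidPDE.curl (u t) x ≠ 0 ∧
        θ < (-t) * inner ℝ (fderiv ℝ (u t) x
          (Literature.Analysis.FluidPDE.vorticityDirection (Literature.Analysis.FluidPDE.curl (u t)) x))
          (Literature.Analysis.FluidPDE.vorticityDirection (Literature.Analysis.FluidPDE.curl (u t)) x)) ∧
      (∀ T < 0, ∀ θ < 1, ∃ t ∈ Set.Ioo T 0, ∃ x : EuclideanSpace ℝ (Fin 3), Literature.Analysis.FluidPDE.curl (u t) x ≠ 0 ∧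
        θ < (-t) * inner ℝ (fderiv ℝ (u t) x
          (Literature.Analysis.FluidPDE.vorticityDirection (Literature.Analysis.FluidPDE.curl (u t)) x))
          (Literature.Analysis.FluidPDE.vorticityDirection (Literature.Analysis.FluidPDE.curl (u t)) x)) ∧
      (∀ T ≤ 0, ∀ θ < 1, ∀ (H : ℝ → ℝ) (B : ℝ), ContDiff ℝ (⊤ : ℕ∞) H → (∀ t, B ≤ H t) →
        ∃ t < T, ∃ x : EuclideanSpace ℝ (Fin 3), Literature.Analysis.FluidPDE.curl (u t) x ≠ 0 ∧
          θ + (-t) * deriv H t < (-t) * inner ℝ (fderiv ℝ (u t) x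
            (Literature.Analysis.FluidPDE.vorticityDirection (Literature.Analysis.FluidPDE.curl (u t)) x))
            (Literature.Analysis.FluidPDE.vorticityDirection (Literature.Analysis.FluidPDE.curl (u t)) x)) :=
  not_clockCeiling_portrait

end Summit.NavierStokesRegularity.NavierStokesRegularity.Theorems

end
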